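import Summits.Ventures.CertifiedManyBodySolver.Downfold.EmeryVanHoveBi2201
import Summits.Ventures.CertifiedManyBodySolver.Downfold.EmeryVanHoveBi2212
import Summits.Ventures.CertifiedManyBodySolver.Downfold.EmeryVanHoveBi2223IP
import Summits.Ventures.CertifiedManyBodySolver.Downfold.EmeryVanHoveBi2223OP
import Summits.Ventures.CertifiedManyBodySolver.Downfold.EmeryVanHoveCCOC
import Summits.Ventures.CertifiedManyBodySolver.Downfold.EmeryVanHoveHg1201
import Summits.Ventures.CertifiedManyBodySolver.Downfold.EmeryVanHoveHg1201P10
import Summits.Ventures.CertifiedManyBodySolver.Downfold.EmeryVanHoveHg1212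
import Summits.Ventures.CertifiedManyBodySolver.Downfold.EmeryVanHoveHg1223IP
import Summits.Ventures.CertifiedManyBodySolver.Downfold.EmeryVanHoveLa214
import Summits.Ventures.CertifiedManyBodySolver.Downfold.EmeryVanHoveNCCO
import Summits.Ventures.CertifiedManyBodySolver.Downfold.EmeryVanHoveTl1223IP
import Summits.Ventures.CertifiedManyBodySolver.Downfold.EmeryVanHoveTl1223OP
import Summits.Ventures.CertifiedManyBodySolver.Downfold.EmeryVanHoveTl2201
import Summits.Ventures.CertifiedManyBodySolver.Downfold.EmeryVanHoveTl2223IP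
import Summits.Ventures.CertifiedManyBodySolver.Downfold.EmeryVanHoveTl2223OP
import Summits.Ventures.CertifiedManyBodySolver.Downfold.EmeryVanHoveYBCO7Plane
import HarnessLib

/-!
# Which side of the van Hove crossing? — at each typed 3BE box's OWN hole count the σ-model Fermi level lies ABOVE the saddle
# point `ε_AB(X)` (hole-like side), certified from the `x_VH` windows; Tl-2201's overdoped row STRADDLES its crossing

Venture CertifiedManyBodySolver, cell `pub/hubbard-downfold` (stage S1), seat hubbard-downfold-mod-4 (technique B); namespace
`Summit.Ventures.CertifiedManyBodySolver.Downfold.Emery`. Everything PROVED (two three-line lemmas + the landed `EmeryVanHove<Tag>` windows).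
WHAT THIS IS NOT: a statement about any material (SCREENING-GRADE boxes); `U = 0` kinematics of the σ model; «above the saddle point» is the
σ-model statement `ε_VH < ε_F` at the box filling — the Fermi-surface TOPOLOGY sentence (hole-like sheet around (π, π) vs electron-like around Γ)
and any comparison with ARPES / AMRO / quantum oscillations [float] is the box file's reading.

* `vhEnergy_lt_of_filling` — `n_H − 1 < x_VH` and `abFilling(ε) = (2 − n_H)/2` ⇒ `ε_VH < ε` (monotonicity of `abFilling`, `xVH = 1 − 2·abFilling(ε_VH)`);
  `lt_vhEnergy_of_filling` — `x_VH < n_H − 1` ⇒ `ε < ε_VH`.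
* per typed box `<box>_fermi_above_vh : HoldsOn (∀ ε, abFilling ε = (2 − n_H)/2 → ε_VH < ε)` — EVERY censused cuprate box except Tl-2201
  (La-214 x = 0 and x = 1/8, Hg-1201 @0/@10 GPa, Bi-2201, Bi-2212, Hg-1212, YBCO7 plane, CCOC, NCCO, the six trilayer planes, Hg-1223 IP);
* Tl-2201 (`emeryBoxTl2201K26Src`, one-body POINT, n_H ∈ [1.25, 1.30], x_VH ∈ [0.2516, 0.2632]): `emeryBoxTl2201K26Src_fermi_below_vh_of_gt` —
  members with `n_H > 1.2632` (the 34b «T_c = 25 K» window p ∈ [0.263, 0.290] and the 34c end member p ≈ 0.30 of box #34) have `ε_F < ε_VH`: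
  the σ model puts overdoped Tl-2201 BEYOND its van Hove crossing, where AMRO / ARPES / quantum oscillations report a large HOLE-like sheet
  [float, REFVALS-2 §45] — a certified MODEL-FORM statement about the σ rows (the axial Cu-4s / apical / Tl–O channel moves the crossing up).

Sources: [HybertsenSchluterChristensen1989, Eq. (1)]; [AndersenEtAl1995, §6]; [PavariniEtAl2001, Eq. (1)].
-/

noncomputable section

namespace Summit.Ventures.CertifiedManyBodySolver.Downfold.Emery

open Real Set
open Summit.Ventures.CertifiedManyBodySolver.Downfold

/-- **Below the van Hove doping ⇒ above the saddle energy**: `n_H − 1 < x_VH`, `abFilling(ε) = (2 − n_H)/2` ⇒ `ε_VH < ε`. [folklore] -/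
theorem vhEnergy_lt_of_filling {Δ tpd tpp c ε nH : ℝ} (hx : nH - 1 < xVH Δ tpd tpp c)
    (hf : abFilling Δ tpd tpp c ε = (2 - nH) / 2) : vhEnergy Δ tpd c < ε := by
  by_contra hle
  have hmono := abFilling_mono Δ tpd tpp c (le_of_not_gt hle)
  unfold xVH at hx
  linarith

/-- **Beyond the van Hove doping ⇒ below the saddle energy**: `x_VH < n_H − 1`, `abFilling(ε) = (2 − n_H)/2` ⇒ `ε < ε_VH`. [folklore] -/
theorem lt_vhEnergy_of_filling {Δ tpd tpp c ε nH : ℝ} (hx : xVH Δ tpd tpp c < nH - 1)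
    (hf : abFilling Δ tpd tpp c ε = (2 - nH) / 2) : ε < vhEnergy Δ tpd c := by
  by_contra hle
  have hmono := abFilling_mono Δ tpd tpp c (le_of_not_gt hle)
  unfold xVH at hx
  linarith

/-- **`emeryBoxLa214M15v123` STRADDLES its van Hove crossing** (n_H ∈ [1.105, 1.145], x_VH ∈ [0.1344, 0.2721]): members with
`n_H − 1 > 0.2721` have their σ Fermi level BELOW the saddle point … [cite: HybertsenSchluterChristensen1989, Eq. (1) (three-band d–p model)] -/
theorem emeryBoxLa214M15v123_fermi_below_vh_of_gt :
    HoldsOn (fun p : EmeryCoord → ℝ => ∀ ε : ℝ,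
      abFilling (p .DeltaPd) (p .tpd) (p .tpp) (p .tppP) ε = (2 - p .nHoles) / 2 →
      (2229 / 8192 : ℝ) < p .nHoles - 1 → ε < vhEnergy (p .DeltaPd) (p .tpd) (p .tppP)) emeryBoxLa214M15v123 := by
  intro p hp ε hf hgt
  obtain ⟨hΔ, ha, hb, hc, -⟩ := emeryBoxLa214M15v123_mem_rows hp
  have hx := (la214Box_xVH hΔ ha hb hc).2.2.2.2
  exact lt_vhEnergy_of_filling (by linarith) hf

/-- … and members with `n_H − 1 < 0.1344` have it ABOVE. [folklore] -/
theorem emeryBoxLa214M15v123_fermi_above_vh_of_lt :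
    HoldsOn (fun p : EmeryCoord → ℝ => ∀ ε : ℝ,
      abFilling (p .DeltaPd) (p .tpd) (p .tpp) (p .tppP) ε = (2 - p .nHoles) / 2 →
      p .nHoles - 1 < (9911 / 73728 : ℝ) → vhEnergy (p .DeltaPd) (p .tpd) (p .tppP) < ε) emeryBoxLa214M15v123 := by
  intro p hp ε hf hlt
  obtain ⟨hΔ, ha, hb, hc, -⟩ := emeryBoxLa214M15v123_mem_rows hp
  have hx := (la214Box_xVH hΔ ha hb hc).2.2.2.1
  exact vhEnergy_lt_of_filling (by linarith) hf

/-- **`emeryBoxLa214v123`** (n_H ∈ [0.99, 1.01], x_VH ≥ 0.1344 > 0.01): at the box's own hole count the σ Fermi level lies ABOVE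
the saddle point at every member. [cite: HybertsenSchluterChristensen1989, Eq. (1) (three-band d–p model)] -/
theorem emeryBoxLa214v123_fermi_above_vh :
    HoldsOn (fun p : EmeryCoord → ℝ => ∀ ε : ℝ,
      abFilling (p .DeltaPd) (p .tpd) (p .tpp) (p .tppP) ε = (2 - p .nHoles) / 2 →
      vhEnergy (p .DeltaPd) (p .tpd) (p .tppP) < ε) emeryBoxLa214v123 := by
  intro p hp ε hf
  obtain ⟨h1, h2, h3, h4, h5, h6, h7, h8, -, -, -, -, -, -, hn1, hn2⟩ := (emeryBoxLa214v123_mem_iff p).1 hp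
  push_cast at h1 h2 h3 h4 h5 h6 h7 h8 hn1 hn2
  have hx := (la214Box_xVH ⟨h1, h2⟩ ⟨h3, h4⟩ ⟨h5, h6⟩ ⟨h7, h8⟩).2.2.2.1
  exact vhEnergy_lt_of_filling (by linarith [hn2]) hf

/-- **`emeryBoxHg1201v114`** (n_H ∈ [1.125, 1.16], x_VH ≥ 0.2150 > 0.16): at the box's own hole count the σ Fermi level lies ABOVE
the saddle point at every member. [cite: HybertsenSchluterChristensen1989, Eq. (1) (three-band d–p model)] -/
theorem emeryBoxHg1201v114_fermi_above_vh :
    HoldsOn (fun p : EmeryCoord → ℝ => ∀ ε : ℝ,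
      abFilling (p .DeltaPd) (p .tpd) (p .tpp) (p .tppP) ε = (2 - p .nHoles) / 2 →
      vhEnergy (p .DeltaPd) (p .tpd) (p .tppP) < ε) emeryBoxHg1201v114 := by
  intro p hp ε hf
  obtain ⟨hΔ, ha, hb, hc, hn⟩ := emeryBoxHg1201v114_mem_rows hp
  have hx := (hg1201Box_xVH hΔ ha hb hc).2.2.2.1
  exact vhEnergy_lt_of_filling (by linarith [hn.2]) hf

/-- **`emeryBoxHg1201P10`** (n_H ∈ [1.125, 1.16], x_VH ≥ 0.2098 > 0.16): at the box's own hole count the σ Fermi level lies ABOVE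
the saddle point at every member. [cite: HybertsenSchluterChristensen1989, Eq. (1) (three-band d–p model)] -/
theorem emeryBoxHg1201P10_fermi_above_vh :
    HoldsOn (fun p : EmeryCoord → ℝ => ∀ ε : ℝ,
      abFilling (p .DeltaPd) (p .tpd) (p .tpp) (p .tppP) ε = (2 - p .nHoles) / 2 →
      vhEnergy (p .DeltaPd) (p .tpd) (p .tppP) < ε) emeryBoxHg1201P10 := by
  intro p hp ε hf
  obtain ⟨h1, h2, h3, h4, h5, h6, h7, h8, -, -, -, -, -, -, hn1, hn2⟩ := (emeryBoxHg1201P10_mem_iff p).1 hp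
  push_cast at h1 h2 h3 h4 h5 h6 h7 h8 hn1 hn2
  have hx := (hg1201P10Box_xVH ⟨h1, h2⟩ ⟨h3, h4⟩ ⟨h5, h6⟩ ⟨h7, h8⟩).2.2.2.1
  exact vhEnergy_lt_of_filling (by linarith [hn2]) hf

/-- **`emeryBoxBi2201M61MoreePPSrc`** (n_H ∈ [1.144, 1.176], x_VH ≥ 0.2123 > 0.176): at the box's own hole count the σ Fermi level lies ABOVE
the saddle point at every member. [cite: HybertsenSchluterChristensen1989, Eq. (1) (three-band d–p model)] -/
theorem emeryBoxBi2201M61MoreePPSrc_fermi_above_vh :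
    HoldsOn (fun p : EmeryCoord → ℝ => ∀ ε : ℝ,
      abFilling (p .DeltaPd) (p .tpd) (p .tpp) (p .tppP) ε = (2 - p .nHoles) / 2 →
      vhEnergy (p .DeltaPd) (p .tpd) (p .tppP) < ε) emeryBoxBi2201M61MoreePPSrc := by
  intro p hp ε hf
  obtain ⟨hΔ, ha, hb, hc, hn⟩ := emeryBoxBi2201M61MoreePPSrc_mem_rows hp
  have hx := (bi2201Box_xVH hΔ ha hb hc).2.2.2.1
  exact vhEnergy_lt_of_filling (by linarith [hn.2]) hf

/-- **`emeryBoxBi2212K26Src`** (n_H ∈ [1.16, 1.2], x_VH ≥ 0.2274 > 0.2): at the box's own hole count the σ Fermi level lies ABOVE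
the saddle point at every member. [cite: HybertsenSchluterChristensen1989, Eq. (1) (three-band d–p model)] -/
theorem emeryBoxBi2212K26Src_fermi_above_vh :
    HoldsOn (fun p : EmeryCoord → ℝ => ∀ ε : ℝ,
      abFilling (p .DeltaPd) (p .tpd) (p .tpp) (p .tppP) ε = (2 - p .nHoles) / 2 →
      vhEnergy (p .DeltaPd) (p .tpd) (p .tppP) < ε) emeryBoxBi2212K26Src := by
  intro p hp ε hf
  obtain ⟨hΔ, ha, hb, hc, hn⟩ := emeryBoxBi2212K26Src_mem_rows hp
  have hx := (bi2212Box_xVH hΔ ha hb hc).2.2.2.1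
  exact vhEnergy_lt_of_filling (by linarith [hn.2]) hf

/-- **`emeryBoxBi2223IPK11Src`** (n_H ∈ [1.156, 1.197], x_VH ≥ 0.2113 > 0.197): at the box's own hole count the σ Fermi level lies ABOVE
the saddle point at every member. [cite: HybertsenSchluterChristensen1989, Eq. (1) (three-band d–p model)] -/
theorem emeryBoxBi2223IPK11Src_fermi_above_vh :
    HoldsOn (fun p : EmeryCoord → ℝ => ∀ ε : ℝ,
      abFilling (p .DeltaPd) (p .tpd) (p .tpp) (p .tppP) ε = (2 - p .nHoles) / 2 →
      vhEnergy (p .DeltaPd) (p .tpd) (p .tppP) < ε) emeryBoxBi2223IPK11Src := by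
  intro p hp ε hf
  obtain ⟨hΔ, ha, hb, hc, hn⟩ := emeryBoxBi2223IPK11Src_mem_rows hp
  have hx := (bi2223IPBox_xVH hΔ ha hb hc).2.2.2.1
  exact vhEnergy_lt_of_filling (by linarith [hn.2]) hf

/-- **`emeryBoxBi2223OPK14Src`** (n_H ∈ [1.156, 1.197], x_VH ≥ 0.2098 > 0.197): at the box's own hole count the σ Fermi level lies ABOVE
the saddle point at every member. [cite: HybertsenSchluterChristensen1989, Eq. (1) (three-band d–p model)] -/
theorem emeryBoxBi2223OPK14Src_fermi_above_vh :
    HoldsOn (fun p : EmeryCoord → ℝ => ∀ ε : ℝ,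
      abFilling (p .DeltaPd) (p .tpd) (p .tpp) (p .tppP) ε = (2 - p .nHoles) / 2 →
      vhEnergy (p .DeltaPd) (p .tpd) (p .tppP) < ε) emeryBoxBi2223OPK14Src := by
  intro p hp ε hf
  obtain ⟨hΔ, ha, hb, hc, hn⟩ := emeryBoxBi2223OPK14Src_mem_rows hp
  have hx := (bi2223OPBox_xVH hΔ ha hb hc).2.2.2.1
  exact vhEnergy_lt_of_filling (by linarith [hn.2]) hf

/-- **`emeryBoxCCOCK26Src`** (n_H ∈ [1.1, 1.1], x_VH ≥ 0.1977 > 0.1): at the box's own hole count the σ Fermi level lies ABOVE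
the saddle point at every member. [cite: HybertsenSchluterChristensen1989, Eq. (1) (three-band d–p model)] -/
theorem emeryBoxCCOCK26Src_fermi_above_vh :
    HoldsOn (fun p : EmeryCoord → ℝ => ∀ ε : ℝ,
      abFilling (p .DeltaPd) (p .tpd) (p .tpp) (p .tppP) ε = (2 - p .nHoles) / 2 →
      vhEnergy (p .DeltaPd) (p .tpd) (p .tppP) < ε) emeryBoxCCOCK26Src := by
  intro p hp ε hf
  obtain ⟨hΔ, ha, hb, hc, hn⟩ := emeryBoxCCOCK26Src_mem_rows hp
  have hx := (cCOCBox_xVH hΔ ha hb hc).2.2.2.1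
  exact vhEnergy_lt_of_filling (by linarith [hn.2]) hf

/-- **`emeryBoxHg1212K26Src`** (n_H ∈ [1.16, 1.2], x_VH ≥ 0.2343 > 0.2): at the box's own hole count the σ Fermi level lies ABOVE
the saddle point at every member. [cite: HybertsenSchluterChristensen1989, Eq. (1) (three-band d–p model)] -/
theorem emeryBoxHg1212K26Src_fermi_above_vh :
    HoldsOn (fun p : EmeryCoord → ℝ => ∀ ε : ℝ,
      abFilling (p .DeltaPd) (p .tpd) (p .tpp) (p .tppP) ε = (2 - p .nHoles) / 2 →
      vhEnergy (p .DeltaPd) (p .tpd) (p .tppP) < ε) emeryBoxHg1212K26Src := by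
  intro p hp ε hf
  obtain ⟨hΔ, ha, hb, hc, hn⟩ := emeryBoxHg1212K26Src_mem_rows hp
  have hx := (hg1212Box_xVH hΔ ha hb hc).2.2.2.1
  exact vhEnergy_lt_of_filling (by linarith [hn.2]) hf

/-- **`emeryBoxHg1223IP`** (n_H ∈ [1.14, 1.2], x_VH ≥ 0.2113 > 0.2): at the box's own hole count the σ Fermi level lies ABOVE
the saddle point at every member. [cite: HybertsenSchluterChristensen1989, Eq. (1) (three-band d–p model)] -/
theorem emeryBoxHg1223IP_fermi_above_vh :
    HoldsOn (fun p : EmeryCoord → ℝ => ∀ ε : ℝ,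
      abFilling (p .DeltaPd) (p .tpd) (p .tpp) (p .tppP) ε = (2 - p .nHoles) / 2 →
      vhEnergy (p .DeltaPd) (p .tpd) (p .tppP) < ε) emeryBoxHg1223IP := by
  intro p hp ε hf
  obtain ⟨hΔ, ha, hb, hc, hn⟩ := emeryBoxHg1223IP_mem_rows hp
  have hx := (hg1223IPBox_xVH hΔ ha hb hc).2.2.2.1
  exact vhEnergy_lt_of_filling (by linarith [hn.2]) hf

/-- **`emeryBoxNCCOK26Src`** (n_H ∈ [0.85, 0.85], x_VH ≥ 0.1751 > -0.15): at the box's own hole count the σ Fermi level lies ABOVE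
the saddle point at every member. [cite: HybertsenSchluterChristensen1989, Eq. (1) (three-band d–p model)] -/
theorem emeryBoxNCCOK26Src_fermi_above_vh :
    HoldsOn (fun p : EmeryCoord → ℝ => ∀ ε : ℝ,
      abFilling (p .DeltaPd) (p .tpd) (p .tpp) (p .tppP) ε = (2 - p .nHoles) / 2 →
      vhEnergy (p .DeltaPd) (p .tpd) (p .tppP) < ε) emeryBoxNCCOK26Src := by
  intro p hp ε hf
  obtain ⟨hΔ, ha, hb, hc, hn⟩ := emeryBoxNCCOK26Src_mem_rows hp
  have hx := (nCCOBox_xVH hΔ ha hb hc).2.2.2.1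
  exact vhEnergy_lt_of_filling (by linarith [hn.2]) hf

/-- **`emeryBoxTl1223IPK11Src`** (n_H ∈ [1.14, 1.18], x_VH ≥ 0.2224 > 0.18): at the box's own hole count the σ Fermi level lies ABOVE
the saddle point at every member. [cite: HybertsenSchluterChristensen1989, Eq. (1) (three-band d–p model)] -/
theorem emeryBoxTl1223IPK11Src_fermi_above_vh :
    HoldsOn (fun p : EmeryCoord → ℝ => ∀ ε : ℝ,
      abFilling (p .DeltaPd) (p .tpd) (p .tpp) (p .tppP) ε = (2 - p .nHoles) / 2 →
      vhEnergy (p .DeltaPd) (p .tpd) (p .tppP) < ε) emeryBoxTl1223IPK11Src := by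
  intro p hp ε hf
  obtain ⟨hΔ, ha, hb, hc, hn⟩ := emeryBoxTl1223IPK11Src_mem_rows hp
  have hx := (tl1223IPBox_xVH hΔ ha hb hc).2.2.2.1
  exact vhEnergy_lt_of_filling (by linarith [hn.2]) hf

/-- **`emeryBoxTl1223OPK11Src`** (n_H ∈ [1.14, 1.18], x_VH ≥ 0.2202 > 0.18): at the box's own hole count the σ Fermi level lies ABOVE
the saddle point at every member. [cite: HybertsenSchluterChristensen1989, Eq. (1) (three-band d–p model)] -/
theorem emeryBoxTl1223OPK11Src_fermi_above_vh :
    HoldsOn (fun p : EmeryCoord → ℝ => ∀ ε : ℝ,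
      abFilling (p .DeltaPd) (p .tpd) (p .tpp) (p .tppP) ε = (2 - p .nHoles) / 2 →
      vhEnergy (p .DeltaPd) (p .tpd) (p .tppP) < ε) emeryBoxTl1223OPK11Src := by
  intro p hp ε hf
  obtain ⟨hΔ, ha, hb, hc, hn⟩ := emeryBoxTl1223OPK11Src_mem_rows hp
  have hx := (tl1223OPBox_xVH hΔ ha hb hc).2.2.2.1
  exact vhEnergy_lt_of_filling (by linarith [hn.2]) hf

/-- **`emeryBoxTl2201K26Src` STRADDLES its van Hove crossing** (n_H ∈ [1.25, 1.3], x_VH ∈ [0.2516, 0.2632]): members with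
`n_H − 1 > 0.2632` have their σ Fermi level BELOW the saddle point … [cite: HybertsenSchluterChristensen1989, Eq. (1) (three-band d–p model)] -/
theorem emeryBoxTl2201K26Src_fermi_below_vh_of_gt :
    HoldsOn (fun p : EmeryCoord → ℝ => ∀ ε : ℝ,
      abFilling (p .DeltaPd) (p .tpd) (p .tpp) (p .tppP) ε = (2 - p .nHoles) / 2 →
      (539 / 2048 : ℝ) < p .nHoles - 1 → ε < vhEnergy (p .DeltaPd) (p .tpd) (p .tppP)) emeryBoxTl2201K26Src := by
  intro p hp ε hf hgt
  obtain ⟨hΔ, ha, hb, hc, -⟩ := emeryBoxTl2201K26Src_mem_rows hp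
  have hx := (tl2201Box_xVH hΔ ha hb hc).2.2.2.2
  exact lt_vhEnergy_of_filling (by linarith) hf

/-- … and members with `n_H − 1 < 0.2516` have it ABOVE. [folklore] -/
theorem emeryBoxTl2201K26Src_fermi_above_vh_of_lt :
    HoldsOn (fun p : EmeryCoord → ℝ => ∀ ε : ℝ,
      abFilling (p .DeltaPd) (p .tpd) (p .tpp) (p .tppP) ε = (2 - p .nHoles) / 2 →
      p .nHoles - 1 < (773 / 3072 : ℝ) → vhEnergy (p .DeltaPd) (p .tpd) (p .tppP) < ε) emeryBoxTl2201K26Src := by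
  intro p hp ε hf hlt
  obtain ⟨hΔ, ha, hb, hc, -⟩ := emeryBoxTl2201K26Src_mem_rows hp
  have hx := (tl2201Box_xVH hΔ ha hb hc).2.2.2.1
  exact vhEnergy_lt_of_filling (by linarith) hf

/-- **`emeryBoxTl2223IPK11Src`** (n_H ∈ [1.14, 1.18], x_VH ≥ 0.2238 > 0.18): at the box's own hole count the σ Fermi level lies ABOVE
the saddle point at every member. [cite: HybertsenSchluterChristensen1989, Eq. (1) (three-band d–p model)] -/
theorem emeryBoxTl2223IPK11Src_fermi_above_vh :
    HoldsOn (fun p : EmeryCoord → ℝ => ∀ ε : ℝ,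
      abFilling (p .DeltaPd) (p .tpd) (p .tpp) (p .tppP) ε = (2 - p .nHoles) / 2 →
      vhEnergy (p .DeltaPd) (p .tpd) (p .tppP) < ε) emeryBoxTl2223IPK11Src := by
  intro p hp ε hf
  obtain ⟨hΔ, ha, hb, hc, hn⟩ := emeryBoxTl2223IPK11Src_mem_rows hp
  have hx := (tl2223IPBox_xVH hΔ ha hb hc).2.2.2.1
  exact vhEnergy_lt_of_filling (by linarith [hn.2]) hf

/-- **`emeryBoxTl2223OPK15Src`** (n_H ∈ [1.14, 1.18], x_VH ≥ 0.2175 > 0.18): at the box's own hole count the σ Fermi level lies ABOVE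
the saddle point at every member. [cite: HybertsenSchluterChristensen1989, Eq. (1) (three-band d–p model)] -/
theorem emeryBoxTl2223OPK15Src_fermi_above_vh :
    HoldsOn (fun p : EmeryCoord → ℝ => ∀ ε : ℝ,
      abFilling (p .DeltaPd) (p .tpd) (p .tpp) (p .tppP) ε = (2 - p .nHoles) / 2 →
      vhEnergy (p .DeltaPd) (p .tpd) (p .tppP) < ε) emeryBoxTl2223OPK15Src := by
  intro p hp ε hf
  obtain ⟨hΔ, ha, hb, hc, hn⟩ := emeryBoxTl2223OPK15Src_mem_rows hp
  have hx := (tl2223OPBox_xVH hΔ ha hb hc).2.2.2.1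
  exact vhEnergy_lt_of_filling (by linarith [hn.2]) hf

/-- **`emeryBoxYBCO7planeY6K26Src`** (n_H ∈ [1.16, 1.165], x_VH ≥ 0.2187 > 0.165): at the box's own hole count the σ Fermi level lies ABOVE
the saddle point at every member. [cite: HybertsenSchluterChristensen1989, Eq. (1) (three-band d–p model)] -/
theorem emeryBoxYBCO7planeY6K26Src_fermi_above_vh :
    HoldsOn (fun p : EmeryCoord → ℝ => ∀ ε : ℝ,
      abFilling (p .DeltaPd) (p .tpd) (p .tpp) (p .tppP) ε = (2 - p .nHoles) / 2 →
      vhEnergy (p .DeltaPd) (p .tpd) (p .tppP) < ε) emeryBoxYBCO7planeY6K26Src := by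
  intro p hp ε hf
  obtain ⟨hΔ, ha, hb, hc, hn⟩ := emeryBoxYBCO7planeY6K26Src_mem_rows hp
  have hx := (yBCO7PlaneBox_xVH hΔ ha hb hc).2.2.2.1
  exact vhEnergy_lt_of_filling (by linarith [hn.2]) hf

end Summit.Ventures.CertifiedManyBodySolver.Downfold.Emery
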